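import Mathlib
import HarnessLib

/-!
# The Markov–Kakutani fixed point theorem

Markov (1936) and Kakutani (1938) proved that a commuting family of continuous affine self-maps
of a nonempty compact convex subset `K` of a (Hausdorff) topological vector space has a common
fixed point.  We follow Reed–Simon [cite: ReedSimonI1980, §V.5 Lemma and Thm V.20]:

* `exists_fixedPoint_of_isAffineOn` — **one map** (the Lemma before Thm V.20): a map `T` which
  is continuous on `K`, maps `K` into itself and is affine on `K` has a fixed point in `K`.
* `exists_forall_fixedPoint_of_commute` — **Markov–Kakutani theorem** (Thm V.20): a family
  `T i` (`i : ι`, any index type) of such maps which commute on `K` has a common fixed point.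
* `exists_forall_fixedPoint_affineMap` — the same for globally defined continuous affine maps
  `E →ᵃ[ℝ] E` leaving `K` invariant.

## Proof

For one map we use the Cesàro averages `cesaro T n x₀ = (1/n) ∑_{k<n} T^k x₀ ∈ K` of an orbit.
Since `T` is affine on `K`, `T (cesaro T n x₀) - cesaro T n x₀ = (1/n) (T^n x₀ - x₀)` lies in
`(1/n) (K - K)`; as `K - K` is compact, hence von Neumann bounded
(`IsCompact.isVonNBounded`), this defect tends to `0` (`IsVonNBounded.smul_tendsto_zero`).
By compactness the sequence of averages has a cluster point `x ∈ K`; continuity of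
`y ↦ T y - y` on `K` makes `T x - x` a cluster value of a sequence tending to `0`, so
`T x = x` by the Hausdorff property.  (Reed–Simon argue with the Hahn–Banach theorem in a
locally convex space; the boundedness argument used here needs no local convexity.)
For a family, the fixed point sets `{x ∈ K | T i x = x}` are compact and convex, each `T j`
leaves the common fixed point set of finitely many `T i` invariant (this is where commutativity
enters), so finite subfamilies have common fixed points by induction, and the full family by
the finite intersection property.

Deviations: `E` is any Hausdorff real topological vector space (topological additive group with
continuous scalar multiplication), local convexity is not assumed; the maps need only be defined
on `E` with continuity, affinity, invariance and commutation required on `K`.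
-/

open Set Filter Topology Bornology

namespace Literature.Analysis.Convex.MarkovKakutani

variable {E : Type*} [AddCommGroup E] [Module ℝ E] [TopologicalSpace E]

/-- `T` is *affine on `K`*: it preserves two-point convex combinations of points of `K`
(Reed–Simon's "affine linear map on a convex set", `T (t x + (1 - t) y) = t T x + (1 - t) T y`,
written with two weights `a, b ≥ 0`, `a + b = 1`).
[cite: ReedSimonI1980, §V.5, Definition preceding Thm V.20 (affine linear map on a convex set)] -/
def IsAffineOn (T : E → E) (K : Set E) : Prop :=
  ∀ ⦃x⦄, x ∈ K → ∀ ⦃y⦄, y ∈ K → ∀ ⦃a b : ℝ⦄, 0 ≤ a → 0 ≤ b → a + b = 1 →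
    T (a • x + b • y) = a • T x + b • T y

omit [TopologicalSpace E] in
/-- Restriction of affinity to a subset. [folklore] -/
private theorem IsAffineOn.mono {T : E → E} {K K' : Set E} (h : IsAffineOn T K) (hK' : K' ⊆ K) :
    IsAffineOn T K' :=
  fun _ hx _ hy _ _ ha hb hab => h (hK' hx) (hK' hy) ha hb hab

omit [TopologicalSpace E] in
/-- A (globally defined) affine map is affine on every set. [folklore] -/
private theorem isAffineOn_affineMap (f : E →ᵃ[ℝ] E) (K : Set E) : IsAffineOn f K :=
  fun _ _ _ _ _ _ _ _ hab => Convex.combo_affine_apply hab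

omit [TopologicalSpace E] in
/-- A map affine on a convex set `K` preserves all finite convex combinations of points of `K`.
[folklore] -/
private theorem IsAffineOn.map_sum {T : E → E} {K : Set E} (hT : IsAffineOn T K) (hK : Convex ℝ K)
    {ι : Type*} (t : Finset ι) (w : ι → ℝ) (z : ι → E) (hw : ∀ i ∈ t, 0 ≤ w i)
    (hw1 : ∑ i ∈ t, w i = 1) (hz : ∀ i ∈ t, z i ∈ K) :
    T (∑ i ∈ t, w i • z i) = ∑ i ∈ t, w i • T (z i) := by
  classical
  induction t using Finset.induction_on generalizing w with
  | empty => simp at hw1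
  | insert a s has ih =>
    rw [Finset.sum_insert has] at hw1
    rw [Finset.sum_insert has, Finset.sum_insert has]
    have hw' : ∀ i ∈ s, 0 ≤ w i := fun i hi => hw i (Finset.mem_insert_of_mem hi)
    have hz' : ∀ i ∈ s, z i ∈ K := fun i hi => hz i (Finset.mem_insert_of_mem hi)
    set W := ∑ i ∈ s, w i with hWdef
    have hW0 : 0 ≤ W := Finset.sum_nonneg hw'
    by_cases hW : W = 0
    · have hws : ∀ i ∈ s, w i = 0 := fun i hi => (Finset.sum_eq_zero_iff_of_nonneg hw').mp hW i hi
      have hwa : w a = 1 := by linarith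
      have h1 : ∑ i ∈ s, w i • z i = 0 :=
        Finset.sum_eq_zero fun i hi => by rw [hws i hi, zero_smul]
      have h2 : ∑ i ∈ s, w i • T (z i) = 0 :=
        Finset.sum_eq_zero fun i hi => by rw [hws i hi, zero_smul]
      rw [h1, h2, hwa, add_zero, add_zero, one_smul, one_smul]
    · have hsum' : ∑ i ∈ s, w i / W = 1 := by rw [← Finset.sum_div, div_self hW]
      have hwW : ∀ i ∈ s, 0 ≤ w i / W := fun i hi => div_nonneg (hw' i hi) hW0
      set y := ∑ i ∈ s, (w i / W) • z i with hydef
      have hy : y ∈ K := hK.sum_mem hwW hsum' hz'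
      have hscale : ∀ (v : ι → E), ∑ i ∈ s, w i • v i = W • ∑ i ∈ s, (w i / W) • v i := by
        intro v
        rw [Finset.smul_sum]
        refine Finset.sum_congr rfl fun i _ => ?_
        rw [smul_smul, mul_div_cancel₀ _ hW]
      have ihy : T y = ∑ i ∈ s, (w i / W) • T (z i) := ih (fun i => w i / W) hwW hsum' hz'
      calc T (w a • z a + ∑ i ∈ s, w i • z i)
          = T (w a • z a + W • y) := by rw [hscale z]
        _ = w a • T (z a) + W • T y :=
            hT (hz a (Finset.mem_insert_self a s)) hy (hw a (Finset.mem_insert_self a s)) hW0 hw1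
        _ = w a • T (z a) + ∑ i ∈ s, w i • T (z i) := by rw [ihy, hscale (fun i => T (z i))]

omit [TopologicalSpace E] in
/-- The fixed point set in a convex set `K` of a map affine on `K` is convex. [folklore] -/
private theorem convex_fixedPoints {T : E → E} {K : Set E} (hT : IsAffineOn T K) (hK : Convex ℝ K) :
    Convex ℝ {x | x ∈ K ∧ T x = x} := by
  intro x hx y hy a b ha hb hab
  exact ⟨hK hx.1 hy.1 ha hb hab, by rw [hT hx.1 hy.1 ha hb hab, hx.2, hy.2]⟩

/-! ### Cesàro averages of an orbit -/

/-- The Cesàro average `(1/n) ∑_{k<n} T^k x` of the orbit of `x`. [folklore] -/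
noncomputable def cesaro (T : E → E) (n : ℕ) (x : E) : E :=
  ∑ k ∈ Finset.range n, (1 / (n : ℝ)) • T^[k] x

omit [TopologicalSpace E] in
/-- Cesàro averages of points of a convex invariant set stay in the set. [folklore] -/
private theorem cesaro_mem {T : E → E} {K : Set E} (hK : Convex ℝ K) (hmaps : MapsTo T K K)
    {x : E} (hx : x ∈ K) {n : ℕ} (hn : n ≠ 0) : cesaro T n x ∈ K := by
  refine hK.sum_mem (fun _ _ => by positivity) ?_ (fun k _ => hmaps.iterate k hx)
  rw [Finset.sum_const, Finset.card_range, nsmul_eq_mul, mul_one_div_cancel]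
  exact Nat.cast_ne_zero.mpr hn

omit [TopologicalSpace E] in
/-- The defect of a Cesàro average: `T (A_n x) - A_n x = (1/n) (T^n x - x)` for `T` affine on a
convex invariant set containing `x`. [folklore] -/
private theorem apply_cesaro_sub_cesaro {T : E → E} {K : Set E} (hT : IsAffineOn T K) (hK : Convex ℝ K)
    (hmaps : MapsTo T K K) {x : E} (hx : x ∈ K) {n : ℕ} (hn : n ≠ 0) :
    T (cesaro T n x) - cesaro T n x = (1 / (n : ℝ)) • (T^[n] x - x) := by
  have hsum : ∑ _k ∈ Finset.range n, (1 / (n : ℝ)) = 1 := by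
    rw [Finset.sum_const, Finset.card_range, nsmul_eq_mul, mul_one_div_cancel]
    exact Nat.cast_ne_zero.mpr hn
  have h1 : T (cesaro T n x) = ∑ k ∈ Finset.range n, (1 / (n : ℝ)) • T^[k + 1] x := by
    unfold cesaro
    rw [hT.map_sum hK (Finset.range n) (fun _ => 1 / (n : ℝ)) (fun k => T^[k] x)
      (fun _ _ => by positivity) hsum (fun k _ => hmaps.iterate k hx)]
    refine Finset.sum_congr rfl fun k _ => ?_
    rw [Function.iterate_succ_apply']
  rw [h1, cesaro, ← Finset.sum_sub_distrib]
  simp_rw [← smul_sub]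
  rw [← Finset.smul_sum, Finset.sum_range_sub (fun k => T^[k] x) n, Function.iterate_zero_apply]

/-! ### One map -/

variable [IsTopologicalAddGroup E] [ContinuousSMul ℝ E] [T2Space E]

/-- **Markov–Kakutani for one map** (Reed–Simon, Lemma before Thm V.20): a map which is
continuous and affine on a nonempty compact convex set `K` of a Hausdorff real topological vector
space and maps `K` into itself has a fixed point in `K`.
[cite: ReedSimonI1980, §V.5, Lemma preceding Thm V.20] -/
theorem exists_fixedPoint_of_isAffineOn {K : Set E} (hKc : IsCompact K) (hKconv : Convex ℝ K)
    (hKne : K.Nonempty) {T : E → E} (hT : ContinuousOn T K) (hmaps : MapsTo T K K)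
    (haff : IsAffineOn T K) : ∃ x ∈ K, T x = x := by
  obtain ⟨x₀, hx₀⟩ := hKne
  let u : ℕ → E := fun n => cesaro T (n + 1) x₀
  have hu : ∀ n, u n ∈ K := fun n => cesaro_mem hKconv hmaps hx₀ (Nat.succ_ne_zero n)
  -- a cluster point of the averages
  have hle : map u atTop ≤ 𝓟 K :=
    le_principal_iff.mpr (eventually_map.mpr (Eventually.of_forall hu))
  obtain ⟨x, hxK, hx⟩ := hKc hle
  -- the defect `T (u n) - u n` tends to zero: it lies in `(1/(n+1)) (K - K)`, `K - K` bounded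
  have hg : Tendsto (fun n => T (u n) - u n) atTop (𝓝 0) := by
    have hD : IsCompact ((fun p : E × E => p.1 - p.2) '' K ×ˢ K) :=
      (hKc.prod hKc).image (continuous_fst.sub continuous_snd)
    have hmem : ∀ᶠ n in atTop, T^[n + 1] x₀ - x₀ ∈ (fun p : E × E => p.1 - p.2) '' K ×ˢ K :=
      Eventually.of_forall fun n => ⟨(T^[n + 1] x₀, x₀), ⟨hmaps.iterate _ hx₀, hx₀⟩, rfl⟩
    have h0 := (hD.isVonNBounded ℝ).smul_tendsto_zero hmem tendsto_one_div_add_atTop_nhds_zero_nat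
    refine h0.congr fun n => ?_
    show (1 / ((n : ℝ) + 1)) • (T^[n + 1] x₀ - x₀) = T (u n) - u n
    rw [apply_cesaro_sub_cesaro haff hKconv hmaps hx₀ (Nat.succ_ne_zero n)]
    push_cast
    rfl
  -- `T x - x` is a cluster value of a sequence tending to `0`, hence `0`
  have hcont : ContinuousWithinAt (fun y => T y - y) K x := (hT.sub continuousOn_id) x hxK
  have key : (𝓝 (T x - x) ⊓ 𝓝 (0 : E)).NeBot := by
    have h1 : (𝓝[K] x ⊓ map u atTop).NeBot := by
      have h : 𝓝[K] x ⊓ map u atTop = 𝓝 x ⊓ map u atTop := by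
        rw [nhdsWithin, inf_assoc, inf_of_le_right hle]
      rw [h]
      exact hx.neBot
    have hc : map (fun y => T y - y) (𝓝[K] x) ≤ 𝓝 (T x - x) := hcont.tendsto
    have h2 : map (fun y => T y - y) (𝓝[K] x ⊓ map u atTop) ≤ 𝓝 (T x - x) ⊓ 𝓝 0 := by
      refine le_inf ((map_mono inf_le_left).trans hc) ?_
      calc map (fun y => T y - y) (𝓝[K] x ⊓ map u atTop)
          ≤ map (fun y => T y - y) (map u atTop) := map_mono inf_le_right
        _ = map ((fun y => T y - y) ∘ u) atTop := map_map
        _ ≤ 𝓝 0 := hg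
    exact (h1.map _).mono h2
  have h0 : T x - x = 0 := eq_of_nhds_neBot key
  exact ⟨x, hxK, sub_eq_zero.mp h0⟩

/-! ### Commuting families -/

/-- **The Markov–Kakutani fixed point theorem** (Markov 1936, Kakutani 1938; Reed–Simon
Thm V.20): let `K` be a nonempty compact convex subset of a Hausdorff real topological vector
space and `T i` (`i : ι`) maps which are continuous and affine on `K`, map `K` into itself and
commute on `K`.  Then the `T i` have a common fixed point in `K`.
[cite: ReedSimonI1980, Thm V.20] -/
theorem exists_forall_fixedPoint_of_commute {ι : Type*} {K : Set E} (hKc : IsCompact K)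
    (hKconv : Convex ℝ K) (hKne : K.Nonempty) {T : ι → E → E}
    (hT : ∀ i, ContinuousOn (T i) K) (hmaps : ∀ i, MapsTo (T i) K K)
    (haff : ∀ i, IsAffineOn (T i) K) (hcomm : ∀ i j, ∀ x ∈ K, T i (T j x) = T j (T i x)) :
    ∃ x ∈ K, ∀ i, T i x = x := by
  classical
  let Fix : ι → Set E := fun i => {x | x ∈ K ∧ T i x = x}
  have hclosed : ∀ i, IsClosed (Fix i) := by
    intro i
    have h := ((hT i).sub continuousOn_id).preimage_isClosed_of_isClosed hKc.isClosed
      (isClosed_singleton (x := (0 : E)))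
    convert h using 1
    ext x
    simp [Fix, sub_eq_zero]
  -- finite subfamilies have common fixed points (induction; commutativity gives invariance)
  have hfin : ∀ s : Finset ι, (K ∩ ⋂ i ∈ s, Fix i).Nonempty := by
    intro s
    induction s using Finset.induction_on with
    | empty => simpa using hKne
    | insert j s hj ih =>
      set Ks := K ∩ ⋂ i ∈ s, Fix i with hKs
      have hKs_sub : Ks ⊆ K := inter_subset_left
      have hKsc : IsCompact Ks := hKc.inter_right (isClosed_biInter fun i _ => hclosed i)
      have hKsconv : Convex ℝ Ks :=
        hKconv.inter (convex_iInter₂ fun i _ => convex_fixedPoints (haff i) hKconv)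
      have hmapsj : MapsTo (T j) Ks Ks := by
        intro x hx
        refine ⟨hmaps j hx.1, mem_iInter₂.mpr fun i hi => ⟨hmaps j hx.1, ?_⟩⟩
        have hxi : x ∈ Fix i := (mem_iInter₂.mp hx.2) i hi
        rw [hcomm i j x hx.1, hxi.2]
      obtain ⟨x, hx, hfx⟩ := exists_fixedPoint_of_isAffineOn hKsc hKsconv ih
        ((hT j).mono hKs_sub) hmapsj ((haff j).mono hKs_sub)
      refine ⟨x, hx.1, ?_⟩
      rw [Finset.set_biInter_insert]
      exact ⟨⟨hx.1, hfx⟩, hx.2⟩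
  obtain ⟨x, hxK, hx⟩ := hKc.inter_iInter_nonempty Fix hclosed hfin
  exact ⟨x, hxK, fun i => ((mem_iInter.mp hx) i).2⟩

/-- **Markov–Kakutani for continuous affine maps of the ambient space**: a commuting family of
continuous affine maps `E →ᵃ[ℝ] E` leaving a nonempty compact convex set `K` invariant has a
common fixed point in `K`. [cite: ReedSimonI1980, Thm V.20] -/
theorem exists_forall_fixedPoint_affineMap {ι : Type*} {K : Set E} (hKc : IsCompact K)
    (hKconv : Convex ℝ K) (hKne : K.Nonempty) (f : ι → E →ᵃ[ℝ] E)
    (hcont : ∀ i, Continuous (f i)) (hmaps : ∀ i, MapsTo (f i) K K)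
    (hcomm : ∀ i j, (f i).comp (f j) = (f j).comp (f i)) :
    ∃ x ∈ K, ∀ i, f i x = x :=
  exists_forall_fixedPoint_of_commute hKc hKconv hKne (fun i => (hcont i).continuousOn) hmaps
    (fun i => isAffineOn_affineMap (f i) K) fun i j x _ => by
      simpa using congrArg (fun g : E →ᵃ[ℝ] E => g x) (hcomm i j)

#harness_tags exists_fixedPoint_of_isAffineOn
#harness_tags exists_forall_fixedPoint_of_commute

end Literature.Analysis.Convex.MarkovKakutani
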